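/-
Copyright (c) 2026 the pub-hodgecm-mathlib formalisation cell (harness21).  Prover seat hodgecm-mathlib-K2E5-p03 (g2),
Track B «K2-LIT» ∕ h413 (stmt-HodgeConjecture-24833), line K2_E5 «TamagawaUnitary», unit G «ZETA ∕ DESCENT», road of socket G1′
`Zeta.sig_K2E5QuatUnitsOneCocompact` (K2E5-plan (g0) DEALS BATCH #8 (a), 2026-09-03T23:12:18Z): PREPARATORY FILE — the generic compact-generation
lemmas, the FIBRE (★ B7 transported to the D-side) and the BASE reduction (Tate's `𝕀¹∕Kˣ` compact + open image of `Nrd`), so that the socket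
follows from ONE arithmetic input (Eichler's norm theorem in the matrix model, K2E5-p08's `K2E5QuatNrdImageLattice`).
2026-09-03.
-/
import Summits.HodgeConjecture.HodgeConjecture.Theorems.K2E5DetSUCocompact             -- ★ B7 (K2E5-p14): `exists_isCompact_forall_inv_mul_mem`, `detSUCocompact`
import Summits.HodgeConjecture.HodgeConjecture.Theorems.K2E5QuatAdelicModuleOneDefs    -- ★ #3j-bis (K2E5-p03): brings ★ #3j `quatAdelicUnitsOne`, `quatRatLatticeOne`, `kerNrdEquivNormOne`, dictionary
import Summits.HodgeConjecture.HodgeConjecture.Theorems.K2E5QuatAdelicNrdSurjectiveOpen -- ★ (K2E5-p08): `isOpenMap_rangeRestrict_quatAdelicNrd`, `isOpen_comap_range_quatAdelicNrd`, `isClosed_range_quatAdelicNrd`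
import Summits.HodgeConjecture.HodgeConjecture.Theorems.K2E5IdeleNormOneLattice         -- ★ (K2E5-p10): `compactSpace_normOneIdeles_quot` (Tate: `𝕀¹_K ∕ Kˣ` compact)
import Literature.NumberTheory.Automorphic.GLnAdelicLocallyCompact                        -- ★ `AdelicGroupData.locallyCompactSpace_generalLinearGroup_adeleRing`
import HarnessLib

/-!
# K2 ∕ E5 «TamagawaUnitary» — unit G, socket G1′ (FUJISAKI for `D_h`), PREPARATORY FILE `K2E5QuatUnitsOneCocompactPrep`:
# compact generation along `1 → SL₁(D_h)(𝔸) → D^{(1)}_{h,𝔸} → Nrd → 𝕀¹ → 1`, reducing `CompactSpace (D^{(1)}_{h,𝔸} ∕ Γ_h)` to Eichler's norm theorem in the model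

Cell `hodgecm-mathlib` (Track B «K2-LIT»), engine E5, item h413 = `stmt-HodgeConjecture-24833` (`--supports … --as helper`); dealt BY NAME by K2E5-plan (g0),
DEALS BATCH #8 (a) (2026-09-03T23:12:18Z) to base K2E5-p03 (g2): socket G1′ `Zeta.sig_K2E5QuatUnitsOneCocompact` of
`Cruxes/H413/Lines/K2_E5_TamagawaUnitary_Zeta.lean` (ED. 1, 83b6ef5607001487) — for an ANISOTROPIC hermitian plane `h` over the CM field `L`,
`CompactSpace (↥(quatAdelicUnitsOne L h) ⧸ quatRatLatticeOne L h)` (Vignéras III Thm. 1.4 (Fujisaki) for the division algebra `D_h`).  THIS FILE proves everything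
of the dealer's road EXCEPT the one arithmetic input, and packages the reduction:

THE ROAD (★ B7's «compact generation» idiom — no quotient-space maps, no transfer of open mappings to quotients):
* §1 GENERIC LEMMAS.  (L1′) `compactSpace_quotient_of_compact_generation`: `G` a topological group, `Γ ≤ G`, `φ : G →* A`; if the kernel is compactly
  generated modulo `Γ` — a compact `C_N ⊆ G` with `∀ n ∈ ker φ, ∃ c ∈ C_N, c⁻¹ n ∈ Γ` — and `G` is compactly generated modulo `Γ · ker φ` — a compact `C_Q ⊆ G` with
  `∀ g, ∃ c ∈ C_Q, ∃ γ ∈ Γ, c⁻¹ g γ ∈ ker φ` — then `G ⧸ Γ` is compact (`univ = π(C_Q · C_N)`).  (L0) `exists_isCompact_image_superset_of_isOpenMap`: a compact subset of the target of an OPEN map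
  from a locally compact space, contained in its range, lifts into a compact set.  (L2′) `exists_isCompact_generation_of_isOpen_subgroup`: `T` locally compact, `T ⧸ P` compact, `Q ≤ T` an OPEN
  subgroup ⇒ a compact `K ⊆ Q` with `∀ q ∈ Q, ∃ k ∈ K, k⁻¹ q ∈ P` (★ B7 `exists_isCompact_forall_inv_mul_mem` + the closedness of `Q · P` + a finite subcover of `K ∩ Q·P` by the open
  cosets `Q p`).
* §2 THE FIBRE (`N = SL₁(D_h)(𝔸)`): the continuous «identity on matrices» `suToUnitsOne : ker detU →* D^{(1)}_{h,𝔸}` (★ #3d `quatAdelicNormOneEquiv`⁻¹, ★ #3j `kerNrdEquivNormOne`⁻¹,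
  ★ #3j `ker_quatAdelicNrd_le_quatAdelicUnitsOne`) hits every element of reduced norm `1` and carries the letter's `SU`-lattice into `Γ_h` (★ #3j dictionary
  `mem_ratSU_iff_mem_quatRatLattice`); with ★ B7 `detSUCocompact` (ANISOTROPY used here) and ★ `exists_isCompact_forall_inv_mul_mem` on the locally compact `ker detU`
  (★ `locallyCompactSpace_kerDetU`) this gives the kernel's compact generation modulo `Γ_h` (`exists_isCompact_kernel_generation`).
* §3 THE BASE (`Q = Nrd`): `y ↦ con y = ideleBaseChange L⁺ L y` identifies `𝕀_{L⁺}` with the `c ⊗ 1`-fixed idèles ⊇ `Nrd((D_h⊗𝔸)^×)` (★ #3i); `‖con y‖_L = ‖y‖²_{L⁺}` (★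
  `ideleNorm_ideleBaseChange`, `[L:L⁺] = 2`) so `Nrd x` has module `1` iff `y ∈ 𝕀¹_{L⁺}`; `Q⁺ = Nrd-range.comap con` is OPEN (★ `isOpen_comap_range_quatAdelicNrd`), `𝕀¹_{L⁺} ∕ L⁺ˣ` is
  COMPACT (★ `compactSpace_normOneIdeles_quot`) and `𝕀¹_{L⁺}` locally compact (★), so (L2′) gives a compact `K′ ⊆ Q⁺ ∩ 𝕀¹` generating `Q⁺ ∩ 𝕀¹` modulo `L⁺ˣ`; (L0) lifts `con(K′)` through
  the OPEN `Nrd.rangeRestrict` (★ `isOpenMap_rangeRestrict_quatAdelicNrd`) into a compact `C ⊆ (D_h ⊗ 𝔸)^×`, automatically inside `D^{(1)}_{h,𝔸}` (closed, ★ #3j).  What is left is to move the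
  PRINCIPAL factor `p ∈ L⁺ˣ ∩ Q⁺` into `Γ_h`: `con p` is a principal idèle of `L` lying in `Nrd((D_h⊗𝔸)^×)`, and **EICHLER'S NORM THEOREM IN THE MODEL** says it is `Nrd γ` for a
  RATIONAL unit `γ ∈ Γ_h` — the hypothesis `hEichler : (quatAdelicNrd L h).range ⊓ principalIdeles L ≤ (quatRatLattice L h).map (quatAdelicNrd L h)` of the reduction theorem
  **`compactSpace_quatUnitsOne_quot_of_eichler`** (§4), to be discharged BY NAME by K2E5-p08's `K2E5QuatNrdImageLattice` (★ D4 `normEichler` transported to `quatRatSubalgebra` +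
  positivity of `Nrd` at the `h`-definite real places); the head `Theorems/K2E5QuatUnitsOneCocompact.lean` is then `compactSpace_quatUnitsOne_quot_of_eichler … (★ (c))`.
HONEST NOTE: without that input the socket is not closable by this road — cocompactness of `Nrd Γ_h` in `Nrd D^{(1)}_{h,𝔸}` is EQUIVALENT to the finiteness of
`[L⁺ˣ ∩ Q⁺ : Nrd D_hˣ]` (= 1 by Eichler); the only Eichler-free road is Fujisaki–Blichfeldt in the model (★ D5 `normFujisaki` lives in the abstract `adelicUnits K D` currency).

HONEST LABEL: HC_CM is proved only modulo the 7 printed citations (2 remaining named inputs: hLiu418 = stmt-HodgeConjecture-24832,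
h413 = stmt-HodgeConjecture-24833) until rung 0 closes; this file is a `--supports stmt-HodgeConjecture-24833` helper (road of G1′) and retires nothing by itself.

## References
* [VignerasLNM800] M.-F. Vignéras, *Arithmétique des algèbres de quaternions*, LNM 800 (1980), Ch. III §1 Thm. 1.4 (Fujisaki), §2 (proof of Thm. 2.3), §4 Thm. 4.1 (Eichler).
* [PlatonovRapinchuk1994] V. Platonov, A. Rapinchuk, *Algebraic groups and number theory* (1994), §5.3 Thm. 5.5 (Godement's criterion), §8.2.
* [WeilBNT1967] A. Weil, *Basic Number Theory* (1967), Ch. IV §3 Thm. 4 (Fujisaki's lemma), §4 Thm. 6 (`k_{A,1}/kˣ` compact).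
* [CasselsFrohlichANT1967] J. W. S. Cassels, A. Fröhlich (eds.), *Algebraic Number Theory* (1967), Ch. II §16 (`J¹_k/kˣ` compact).
-/

set_option autoImplicit false
-- the mandated namespace repeats the single-problem summit's segment (`HodgeConjecture.HodgeConjecture`)
set_option linter.dupNamespace false

noncomputable section

namespace Summit.HodgeConjecture.HodgeConjecture.Cruxes.H413.K2E5QuatUnitsOneCocompactPrep

open NumberField IsDedekindDomain Topology
open Literature.NumberTheory.Automorphic Literature.NumberTheory.K2Lit.UnitaryDetFibration
open Literature.NumberTheory.GaloisRepresentations (principalIdeles ideleGroup)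
open Summit.HodgeConjecture.HodgeConjecture.Cruxes.H413.K2E5QuatAdelicMatrixModel
open Summit.HodgeConjecture.HodgeConjecture.Cruxes.H413.K2E5QuatAdelicRat
open Summit.HodgeConjecture.HodgeConjecture.Cruxes.H413.K2E5QuatAdelicNrd
open Summit.HodgeConjecture.HodgeConjecture.Cruxes.H413.K2E5QuatAdelicLattice
open Summit.HodgeConjecture.HodgeConjecture.Cruxes.H413.K2E5QuatAdelicModuleOne
open Summit.HodgeConjecture.HodgeConjecture.Cruxes.H413.K2E5QuatAdelicNrdSurjectiveOpen
open Summit.HodgeConjecture.HodgeConjecture.Cruxes.H413.K2E5DetSUCocompact (exists_isCompact_forall_inv_mul_mem detSUCocompact)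
open Summit.HodgeConjecture.HodgeConjecture.Cruxes.H413.K2E5IdeleNormOneLattice (compactSpace_normOneIdeles_quot)
open scoped Matrix MatrixGroups NNReal Pointwise

/-! ## §1 Generic compact-generation lemmas -/

section Generic

/-- **(L1′) COMPACT GENERATION ALONG A HOMOMORPHISM.**  Let `G` be a topological group, `Γ ≤ G`, `φ : G →* A`.  If the kernel of `φ` is compactly generated
modulo `Γ` (`∀ n ∈ ker φ, ∃ c ∈ C_N, c⁻¹ n ∈ Γ`, `C_N` compact) and `G` is compactly generated modulo `Γ · ker φ` (`∀ g, ∃ c ∈ C_Q, ∃ γ ∈ Γ, c⁻¹ g γ ∈ ker φ`, `C_Q` compact),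
then `G ⧸ Γ` is compact: `g = c · n · γ⁻¹` with `n = c′ γ′`, so `G = (C_Q · C_N) · Γ` and `G ⧸ Γ = π(C_Q · C_N)`. [cite: PlatonovRapinchuk1994, §5.3 Thm. 5.5 (Godement compactness criterion)]
[cite: VignerasLNM800, Ch. III §2 (proof of Thm. 2.3: the exact sequence `1 → H¹_A/H¹_K → H_{A,1}/H_K → K_{A,1}/K → 1`)] -/
theorem compactSpace_quotient_of_compact_generation {G A : Type*} [Group G] [TopologicalSpace G] [IsTopologicalGroup G] [Group A]
    (Γ : Subgroup G) (φ : G →* A)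
    (hN : ∃ C : Set G, IsCompact C ∧ ∀ n : G, φ n = 1 → ∃ c ∈ C, c⁻¹ * n ∈ Γ)
    (hQ : ∃ C : Set G, IsCompact C ∧ ∀ g : G, ∃ c ∈ C, ∃ γ ∈ Γ, φ (c⁻¹ * g * γ) = 1) :
    CompactSpace (G ⧸ Γ) := by
  obtain ⟨CN, hCN, hN⟩ := hN
  obtain ⟨CQ, hCQ, hQ⟩ := hQ
  have hgen : ∀ g : G, ∃ k ∈ CQ * CN, k⁻¹ * g ∈ Γ := by
    intro g
    obtain ⟨c, hc, γ, hγ, hker⟩ := hQ g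
    obtain ⟨c', hc', hmem⟩ := hN (c⁻¹ * g * γ) hker
    refine ⟨c * c', Set.mul_mem_mul hc hc', ?_⟩
    have h : (c * c')⁻¹ * g = c'⁻¹ * (c⁻¹ * g * γ) * γ⁻¹ := by group
    rw [h]
    exact Γ.mul_mem hmem (Γ.inv_mem hγ)
  refine ⟨?_⟩
  have hsurj : (QuotientGroup.mk '' (CQ * CN) : Set (G ⧸ Γ)) = Set.univ := by
    refine Set.eq_univ_of_forall fun q => ?_
    induction q using QuotientGroup.induction_on with
    | H g =>
      obtain ⟨k, hk, hkg⟩ := hgen g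
      exact ⟨k, hk, (QuotientGroup.eq.2 hkg)⟩
  rw [← hsurj]
  exact (hCQ.mul hCN).image continuous_quotient_mk'

/-- **(L0) LIFTING COMPACT SETS THROUGH AN OPEN MAP.**  If `f : G → X` is an open map from a (weakly) locally compact space, every compact `K ⊆ range f` is contained in
the image of a compact set (cover `K` by the images of compact neighbourhoods of chosen preimages). [folklore] -/
theorem exists_isCompact_image_superset_of_isOpenMap {G X : Type*} [TopologicalSpace G] [WeaklyLocallyCompactSpace G] [TopologicalSpace X]
    {f : G → X} (hf : IsOpenMap f) {K : Set X} (hK : IsCompact K) (hKf : K ⊆ Set.range f) :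
    ∃ C : Set G, IsCompact C ∧ K ⊆ f '' C := by
  classical
  -- a compact neighbourhood of a preimage of each point of the range
  have h : ∀ x ∈ K, ∃ N : Set G, IsCompact N ∧ f '' N ∈ 𝓝 x := by
    intro x hx
    obtain ⟨g, rfl⟩ := hKf hx
    obtain ⟨N, hNc, hNg⟩ := exists_compact_mem_nhds g
    exact ⟨N, hNc, hf.image_mem_nhds hNg⟩
  choose! N hNc hNn using h
  obtain ⟨t, htK, hKt⟩ := hK.elim_nhds_subcover (fun x => f '' N x) fun x hx => hNn x hx
  refine ⟨⋃ x ∈ t, N x, t.isCompact_biUnion fun x hx => hNc x (htK x hx), ?_⟩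
  intro y hy
  obtain ⟨x, hxt, hyx⟩ := Set.mem_iUnion₂.1 (hKt hy)
  obtain ⟨g, hg, rfl⟩ := hyx
  exact ⟨g, Set.mem_iUnion₂.2 ⟨x, hxt, hg⟩, rfl⟩

/-- For an OPEN subgroup `Q` of a topological group and any subgroup `P`, the set `Q · P` is CLOSED (its complement is a union of right cosets `Q t`, which are open).
[folklore] -/
theorem isClosed_coe_mul_of_isOpen {T : Type*} [Group T] [TopologicalSpace T] [IsTopologicalGroup T] (Q P : Subgroup T) (hQ : IsOpen (Q : Set T)) :
    IsClosed ((Q : Set T) * (P : Set T)) := by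
  rw [← isOpen_compl_iff, isOpen_iff_forall_mem_open]
  intro t ht
  refine ⟨(fun q => q * t) '' (Q : Set T), ?_, (Homeomorph.mulRight t).isOpenMap _ hQ, ⟨1, Q.one_mem, one_mul t⟩⟩
  rintro _ ⟨q₁, hq₁, rfl⟩ hmem
  obtain ⟨q₂, hq₂, p, hp, h⟩ := Set.mem_mul.1 hmem
  apply ht
  refine Set.mem_mul.2 ⟨q₁⁻¹ * q₂, Q.mul_mem (Q.inv_mem hq₁) hq₂, p, hp, ?_⟩
  rw [mul_assoc, h, inv_mul_cancel_left]

/-- **(L2′) COMPACT GENERATION OF AN OPEN SUBGROUP.**  Let `T` be a locally compact group, `P ≤ T` with `T ⧸ P` compact, and `Q ≤ T` an OPEN subgroup.  Then there is a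
compact `K ⊆ Q` with `∀ q ∈ Q, ∃ k ∈ K, k⁻¹ q ∈ P` (so `Q = K · (Q ∩ P)`): take `K₀` compact with `K₀ · P = T` (★ `exists_isCompact_forall_inv_mul_mem`), cover the compact
`K₀ ∩ Q·P` by the open cosets `Q p`, `p ∈ P`, extract `p₁, …, p_m`, and put `K = ⋃_i (K₀ p_i⁻¹) ∩ Q`. [cite: CasselsFrohlichANT1967, Ch. II §16] [cite: WeilBNT1967, Ch. IV §4 Thm. 6] -/
theorem exists_isCompact_generation_of_isOpen_subgroup {T : Type*} [Group T] [TopologicalSpace T] [IsTopologicalGroup T] [LocallyCompactSpace T]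
    (P Q : Subgroup T) [CompactSpace (T ⧸ P)] (hQ : IsOpen (Q : Set T)) :
    ∃ K : Set T, IsCompact K ∧ K ⊆ Q ∧ ∀ q ∈ Q, ∃ k ∈ K, k⁻¹ * q ∈ P := by
  classical
  obtain ⟨K₀, hK₀, hK₀P⟩ := exists_isCompact_forall_inv_mul_mem P
  have hQc : IsClosed (Q : Set T) := Q.isClosed_of_isOpen hQ
  -- the compact set `K₀ ∩ Q·P` is covered by the open cosets `Q p`
  have hKQP : IsCompact (K₀ ∩ ((Q : Set T) * (P : Set T))) := hK₀.inter_right (isClosed_coe_mul_of_isOpen Q P hQ)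
  have hcover : K₀ ∩ ((Q : Set T) * (P : Set T)) ⊆ ⋃ p : ↥P, (fun q => q * (p : T)) '' (Q : Set T) := by
    rintro k ⟨-, hk⟩
    obtain ⟨q, hq, p, hp, rfl⟩ := Set.mem_mul.1 hk
    exact Set.mem_iUnion.2 ⟨⟨p, hp⟩, q, hq, rfl⟩
  obtain ⟨s, hs⟩ := hKQP.elim_finite_subcover (fun p : ↥P => (fun q => q * (p : T)) '' (Q : Set T))
    (fun p => (Homeomorph.mulRight (p : T)).isOpenMap _ hQ) hcover
  refine ⟨⋃ p ∈ s, ((fun k => k * (p : T)⁻¹) '' K₀) ∩ (Q : Set T),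
    s.isCompact_biUnion fun p _ => (hK₀.image (continuous_id.mul continuous_const)).inter_right hQc,
    Set.iUnion₂_subset fun p _ => Set.inter_subset_right, fun q hq => ?_⟩
  obtain ⟨k, hk, hkq⟩ := hK₀P q
  -- `k = q (k⁻¹ q)⁻¹ ∈ Q·P`, so `k ∈ Q p` for some `p ∈ s`
  have hkQP : k ∈ K₀ ∩ ((Q : Set T) * (P : Set T)) :=
    ⟨hk, Set.mem_mul.2 ⟨q, hq, (k⁻¹ * q)⁻¹, P.inv_mem hkq, by group⟩⟩
  obtain ⟨p, hps, hkp⟩ := Set.mem_iUnion₂.1 (hs hkQP)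
  obtain ⟨q', hq', hq'k⟩ := hkp
  refine ⟨k * (p : T)⁻¹, Set.mem_iUnion₂.2 ⟨p, hps, ⟨k, hk, rfl⟩, ?_⟩, ?_⟩
  · -- `k p⁻¹ = q' ∈ Q`
    have h : k * (p : T)⁻¹ = q' := by rw [← hq'k, mul_inv_cancel_right]
    rw [h]
    exact hq'
  · -- `(k p⁻¹)⁻¹ q = p (k⁻¹ q) ∈ P`
    have h : (k * (p : T)⁻¹)⁻¹ * q = (p : T) * (k⁻¹ * q) := by group
    rw [h]
    exact P.mul_mem p.2 hkq

end Generic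

/-! ## §2 The fibre: `SL₁(D_h)(𝔸)` is compactly generated modulo `Γ_h` (★ B7 transported) -/

section Fibre

variable (L : Type) [Field L] [NumberField L] [IsCMField L] (Ha : Matrix (Fin 2) (Fin 2) L)

/-- **THE FIBRE.**  For an anisotropic hermitian plane `h`, the elements of reduced norm `1` in `D^{(1)}_{h,𝔸}` are compactly generated modulo `Γ_h`: there is a compact
`C ⊆ D^{(1)}_{h,𝔸}` with `∀ n, Nrd n = 1 → ∃ c ∈ C, c⁻¹ n ∈ Γ_h`.  Proof: ★ B7 `detSUCocompact` (`SU(h)(L⁺) \ SU(h)(𝔸)` compact — the anisotropy is used HERE) and ★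
`exists_isCompact_forall_inv_mul_mem` on the locally compact `ker detU` give a compact `K ⊆ SU(h)(𝔸)` with `K · SU(h)(L⁺) = SU(h)(𝔸)`; push it through the continuous
«identity on matrices» `ker detU → SL₁(D_h)(𝔸) → D^{(1)}_{h,𝔸}` (★ #3d `quatAdelicNormOneEquiv`⁻¹, ★ #3j `kerNrdEquivNormOne`⁻¹, `ker_quatAdelicNrd_le_quatAdelicUnitsOne`), which is onto
the norm-one elements and carries `SU(h)(L⁺)` into `Γ_h` (★ #3j dictionary `mem_ratSU_iff_mem_quatRatLattice`).
[cite: VignerasLNM800, Ch. III §1 Thm. 1.4 (Fujisaki), §2] [cite: PlatonovRapinchuk1994, §5.3 Thm. 5.5] -/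
theorem exists_isCompact_kernel_generation (hHa : (Ha.map (cmConjRingHom L)).transpose = Ha)
    (han : ∀ x : Fin 2 → L, Literature.AlgebraicGeometry.ShimuraVarieties.hermForm (cmConjRingHom L) Ha x x = 0 → x = 0) (hdet : Ha.det ≠ 0) :
    ∃ C : Set ↥(quatAdelicUnitsOne L Ha), IsCompact C ∧
      ∀ n : ↥(quatAdelicUnitsOne L Ha), quatAdelicNrd L Ha (n : ↥(quatAdelicUnits L Ha)) = 1 →
        ∃ c ∈ C, c⁻¹ * n ∈ quatRatLatticeOne L Ha := by
  haveI := detSUCocompact L Ha hHa han hdet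
  haveI := locallyCompactSpace_kerDetU L Ha hdet
  obtain ⟨K, hK, hKΓ⟩ :=
    exists_isCompact_forall_inv_mul_mem (((UnitaryGroup.cmDatum L 2 Ha).quotientSubgroup).subgroupOf (detU L Ha hdet).ker)
  -- the continuous «identity on matrices» `SU(h)(𝔸) = ker detU → SL₁(D_h)(𝔸) → D^{(1)}_{h,𝔸}`
  let ι : ↥(detU L Ha hdet).ker →* ↥(quatAdelicUnitsOne L Ha) :=
    (Subgroup.inclusion (ker_quatAdelicNrd_le_quatAdelicUnitsOne L Ha)).comp
      ((kerNrdEquivNormOne L Ha).symm.toMonoidHom.comp (quatAdelicNormOneEquiv L Ha hdet).symm.toMonoidHom)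
  have hιapply : ∀ u : ↥(detU L Ha hdet).ker,
      ι u = Subgroup.inclusion (ker_quatAdelicNrd_le_quatAdelicUnitsOne L Ha)
        ((kerNrdEquivNormOne L Ha).symm ((quatAdelicNormOneEquiv L Ha hdet).symm u)) := fun _ => rfl
  have hι : Continuous ι :=
    (continuous_inclusion (ker_quatAdelicNrd_le_quatAdelicUnitsOne L Ha)).comp
      ((continuous_kerNrdEquivNormOne_symm L Ha).comp (continuous_quatAdelicNormOneEquiv_symm L Ha hdet))
  refine ⟨ι '' K, hK.image hι, fun n hn => ?_⟩
  -- `n = ι u` for the corresponding element `u ∈ SU(h)(𝔸)`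
  have hnker : (n : ↥(quatAdelicUnits L Ha)) ∈ (quatAdelicNrd L Ha).ker := (MonoidHom.mem_ker).2 hn
  set x : ↥(quatAdelicNrd L Ha).ker := ⟨(n : ↥(quatAdelicUnits L Ha)), hnker⟩ with hx
  set u : ↥(detU L Ha hdet).ker := quatAdelicNormOneEquiv L Ha hdet (kerNrdEquivNormOne L Ha x) with hu
  have hιu : ι u = n := by
    apply Subtype.ext
    rw [hιapply, hu, MulEquiv.symm_apply_apply, MulEquiv.symm_apply_apply, Subgroup.coe_inclusion]
  obtain ⟨k, hk, hku⟩ := hKΓ u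
  refine ⟨ι k, Set.mem_image_of_mem ι hk, ?_⟩
  have hs : (ι k)⁻¹ * n = ι (k⁻¹ * u) := by rw [map_mul, map_inv, hιu]
  rw [hs, mem_quatRatLatticeOne_iff, hιapply, Subgroup.coe_inclusion]
  -- the ★ #3j dictionary: `SU(h)(L⁺) ↦ Γ_h`
  have key := (mem_ratSU_iff_mem_quatRatLattice L Ha hdet
    ((kerNrdEquivNormOne L Ha).symm ((quatAdelicNormOneEquiv L Ha hdet).symm (k⁻¹ * u)))).1
  rw [MulEquiv.apply_symm_apply, MulEquiv.apply_symm_apply] at key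
  exact key hku

end Fibre

/-! ## §3 The base: compact generation of `D^{(1)}_{h,𝔸}` modulo `Γ_h · SL₁(D_h)(𝔸)`, given Eichler's norm theorem in the model -/

section Base

variable (L : Type) [Field L] [NumberField L] [IsCMField L] (Ha : Matrix (Fin 2) (Fin 2) L)

/-- `‖con y‖_L = 1 ↔ ‖y‖_{L⁺} = 1` (★ `ideleNorm_ideleBaseChange`: `‖con y‖_L = ‖y‖²_{L⁺}`). [cite: WeilBNT1967, Ch. IV §3 Cor. of Prop. 3] -/
theorem ideleNorm_ideleBaseChange_eq_one_iff (y : (AdeleRing (𝓞 ↥(maximalRealSubfield L)) ↥(maximalRealSubfield L))ˣ) :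
    IdeleClassGroup.ideleNorm L (AdeleRing.ideleBaseChange (↥(maximalRealSubfield L)) L y) = 1 ↔
      IdeleClassGroup.ideleNorm ↥(maximalRealSubfield L) y = 1 := by
  rw [Literature.NumberTheory.AdelicBaseChange.ideleNorm_ideleBaseChange, Algebra.IsQuadraticExtension.finrank_eq_two]
  constructor
  · intro h
    have h' : ((IdeleClassGroup.ideleNorm ↥(maximalRealSubfield L) y : ℝ≥0) : ℝ) ^ 2 = 1 := by exact_mod_cast h
    have h0 : (0 : ℝ) ≤ (IdeleClassGroup.ideleNorm ↥(maximalRealSubfield L) y : ℝ≥0) := NNReal.coe_nonneg _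
    exact_mod_cast (pow_eq_one_iff_of_nonneg h0 two_ne_zero).1 h'
  · intro h
    rw [h, one_pow]

omit [IsCMField L] in
/-- The base change of a principal idèle of `L⁺` is a principal idèle of `L` (`AdeleRing.baseChange_algebraMap`). [folklore] -/
theorem ideleBaseChange_mem_principalIdeles_of_mem {p : (AdeleRing (𝓞 ↥(maximalRealSubfield L)) ↥(maximalRealSubfield L))ˣ}
    (hp : p ∈ principalIdeles ↥(maximalRealSubfield L)) : AdeleRing.ideleBaseChange (↥(maximalRealSubfield L)) L p ∈ principalIdeles L := by
  obtain ⟨a, rfl⟩ := hp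
  refine ⟨Units.map (algebraMap (↥(maximalRealSubfield L)) L).toMonoidHom a, Units.ext ?_⟩
  rw [Units.coe_map, AdeleRing.coe_ideleBaseChange, Units.coe_map]
  exact (AdeleRing.baseChange_algebraMap (↥(maximalRealSubfield L)) L (a : ↥(maximalRealSubfield L))).symm

/-- The reduced norm of an element of `D^{(1)}_{h,𝔸}` is `con y` for a NORM-ONE idèle `y ∈ 𝕀¹_{L⁺}` (Galois descent ★ #3i + the module, `‖con y‖ = ‖y‖²`). [cite: VignerasLNM800, Ch. III §1 (X_{A,1})] -/
theorem exists_ideleBaseChange_eq_quatAdelicNrd (hdet : Ha.det ≠ 0) (g : ↥(quatAdelicUnitsOne L Ha)) :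
    ∃ y : (AdeleRing (𝓞 ↥(maximalRealSubfield L)) ↥(maximalRealSubfield L))ˣ, y ∈ normOneIdeles ↥(maximalRealSubfield L) ∧
      AdeleRing.ideleBaseChange (↥(maximalRealSubfield L)) L y = quatAdelicNrd L Ha (g : ↥(quatAdelicUnits L Ha)) := by
  have hfix : quatAdelicNrd L Ha (g : ↥(quatAdelicUnits L Ha)) ∈ (AdeleRing.ideleBaseChange (↥(maximalRealSubfield L)) L).range := by
    rw [← fixedAdelicUnits_eq_range_ideleBaseChange]
    exact quatAdelicNrd_mem_fixedAdelicUnits L Ha hdet _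
  obtain ⟨y, hy⟩ := hfix
  refine ⟨y, ?_, hy⟩
  rw [mem_normOneIdeles, ← ideleNorm_ideleBaseChange_eq_one_iff L, hy]
  exact (mem_quatAdelicUnitsOne_iff L Ha _).1 g.2

/-- **THE BASE.**  Assume EICHLER'S NORM THEOREM IN THE MODEL: a principal idèle which is an adelic reduced norm of `D_h` is the reduced norm of a rational unit
(`hEichler`).  Then `D^{(1)}_{h,𝔸}` is compactly generated modulo `Γ_h · SL₁(D_h)(𝔸)`: there is a compact `C ⊆ D^{(1)}_{h,𝔸}` with `∀ g, ∃ c ∈ C, ∃ γ ∈ Γ_h,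
Nrd (c⁻¹ g γ) = 1`.  Proof: `𝕀¹_{L⁺} ∕ L⁺ˣ` is compact (★ `compactSpace_normOneIdeles_quot`), `Q⁺ = Nrd-range.comap con` is an OPEN subgroup of `𝕀_{L⁺}` (★
`isOpen_comap_range_quatAdelicNrd`), so (L2′) `Q⁺ ∩ 𝕀¹ = K′ · (L⁺ˣ ∩ Q⁺)` with `K′` compact; (L0) lifts `con(K′)` through the OPEN `Nrd.rangeRestrict` (★
`isOpenMap_rangeRestrict_quatAdelicNrd`) into a compact `C` (inside `D^{(1)}`: module one); for `g ∈ D^{(1)}`, `Nrd g = con y`, `y = k p`, `k ∈ K′`, `p ∈ L⁺ˣ ∩ Q⁺`, and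
`con p ∈ Nrd-range ∩ Lˣ = Nrd Γ_h` by `hEichler`. [cite: VignerasLNM800, Ch. III §2 (proof of Thm. 2.3), Ch. III §4 Thm. 4.1 (Eichler)] [cite: CasselsFrohlichANT1967, Ch. II §16] -/
theorem exists_isCompact_base_generation (hHa : (Ha.map (cmConjRingHom L)).transpose = Ha) (hdet : Ha.det ≠ 0)
    (hEichler : (quatAdelicNrd L Ha).range ⊓ principalIdeles L ≤ (quatRatLattice L Ha).map (quatAdelicNrd L Ha)) :
    ∃ C : Set ↥(quatAdelicUnitsOne L Ha), IsCompact C ∧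
      ∀ g : ↥(quatAdelicUnitsOne L Ha), ∃ c ∈ C, ∃ γ ∈ quatRatLatticeOne L Ha,
        quatAdelicNrd L Ha ((c⁻¹ * g * γ : ↥(quatAdelicUnitsOne L Ha)) : ↥(quatAdelicUnits L Ha)) = 1 := by
  -- the base field side: `T¹ = 𝕀¹_{L⁺}`, `P = L⁺ˣ`, `Q = Q⁺ ∩ T¹` (open)
  set con := AdeleRing.ideleBaseChange (↥(maximalRealSubfield L)) L with hcon
  set Qp : Subgroup (AdeleRing (𝓞 ↥(maximalRealSubfield L)) ↥(maximalRealSubfield L))ˣ := ((quatAdelicNrd L Ha).range).comap con with hQp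
  haveI := compactSpace_normOneIdeles_quot ↥(maximalRealSubfield L)
  haveI := locallyCompactSpace_normOneIdeles ↥(maximalRealSubfield L)
  have hQopen : IsOpen ((Qp.subgroupOf (normOneIdeles ↥(maximalRealSubfield L)) : Subgroup ↥(normOneIdeles ↥(maximalRealSubfield L))) :
      Set ↥(normOneIdeles ↥(maximalRealSubfield L))) := by
    rw [Subgroup.coe_subgroupOf]
    exact (isOpen_comap_range_quatAdelicNrd L Ha hHa hdet).preimage continuous_subtype_val
  obtain ⟨K', hK'c, hK'Q, hK'gen⟩ := exists_isCompact_generation_of_isOpen_subgroup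
    ((principalIdeles ↥(maximalRealSubfield L)).subgroupOf (normOneIdeles ↥(maximalRealSubfield L)))
    (Qp.subgroupOf (normOneIdeles ↥(maximalRealSubfield L))) hQopen
  -- lift `con(K′)` through the open `Nrd.rangeRestrict` into a compact `C₀ ⊆ (D_h ⊗ 𝔸)^×`
  haveI : LocallyCompactSpace (GL (Fin 2) (AdeleRing (𝓞 L) L)) := AdelicGroupData.locallyCompactSpace_generalLinearGroup_adeleRing L (Fin 2)
  haveI : LocallyCompactSpace ↥(quatAdelicUnits L Ha) := (isClosed_quatAdelicUnits L Ha).isClosedEmbedding_subtypeVal.locallyCompactSpace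
  have hβ : Continuous fun k : ↥(normOneIdeles ↥(maximalRealSubfield L)) => con (k : (AdeleRing (𝓞 ↥(maximalRealSubfield L)) ↥(maximalRealSubfield L))ˣ) :=
    (Continuous.units_map _ (AdeleRing.continuous_baseChange (↥(maximalRealSubfield L)) L)).comp continuous_subtype_val
  set S : Set (AdeleRing (𝓞 L) L)ˣ :=
    (fun k : ↥(normOneIdeles ↥(maximalRealSubfield L)) => con (k : (AdeleRing (𝓞 ↥(maximalRealSubfield L)) ↥(maximalRealSubfield L))ˣ)) '' K' with hS
  have hSc : IsCompact S := hK'c.image hβ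
  have hSrange : S ⊆ ((quatAdelicNrd L Ha).range : Set (AdeleRing (𝓞 L) L)ˣ) := by
    rintro _ ⟨k, hk, rfl⟩
    exact (Subgroup.mem_comap.1 ((Subgroup.mem_subgroupOf).1 (hK'Q hk)))
  haveI : T2Space (AdeleRing (𝓞 L) L)ˣ := t2Space_ideleGroup L
  have hKRc : IsCompact ((Subtype.val : ↥(quatAdelicNrd L Ha).range → (AdeleRing (𝓞 L) L)ˣ) ⁻¹' S) :=
    (isClosed_range_quatAdelicNrd L Ha hHa hdet).isClosedEmbedding_subtypeVal.isCompact_preimage hSc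
  obtain ⟨C₀, hC₀, hC₀S⟩ := exists_isCompact_image_superset_of_isOpenMap (isOpenMap_rangeRestrict_quatAdelicNrd L Ha hHa hdet) hKRc
    (fun r _ => MonoidHom.rangeRestrict_surjective _ r)
  -- `C := C₀ ∩ D^{(1)}` read inside `D^{(1)}` (a closed subgroup: closed embedding)
  refine ⟨(Subtype.val : ↥(quatAdelicUnitsOne L Ha) → ↥(quatAdelicUnits L Ha)) ⁻¹' C₀,
    (isClosed_quatAdelicUnitsOne L Ha).isClosedEmbedding_subtypeVal.isCompact_preimage hC₀, fun g => ?_⟩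
  -- `Nrd g = con y`, `y ∈ 𝕀¹_{L⁺} ∩ Q⁺`, `y = k · p` with `k ∈ K′`, `p ∈ L⁺ˣ`
  obtain ⟨y, hy1, hy⟩ := exists_ideleBaseChange_eq_quatAdelicNrd L Ha hdet g
  have hyQ : (⟨y, hy1⟩ : ↥(normOneIdeles ↥(maximalRealSubfield L))) ∈ Qp.subgroupOf (normOneIdeles ↥(maximalRealSubfield L)) := by
    rw [Subgroup.mem_subgroupOf, Subgroup.mem_comap]
    exact ⟨(g : ↥(quatAdelicUnits L Ha)), hy.symm⟩
  obtain ⟨k, hkK', hkp⟩ := hK'gen _ hyQ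
  rw [Subgroup.mem_subgroupOf] at hkp
  -- `hkp : (k : 𝕀_{L⁺})⁻¹ * y ∈ L⁺ˣ`
  have hkp' : ((k : (AdeleRing (𝓞 ↥(maximalRealSubfield L)) ↥(maximalRealSubfield L))ˣ))⁻¹ * y ∈ principalIdeles ↥(maximalRealSubfield L) := by
    simpa only [Subgroup.coe_mul, Subgroup.coe_inv] using hkp
  -- a lift `c₀ ∈ C₀` of `con k`, automatically of module one
  have hkS : (⟨con (k : (AdeleRing (𝓞 ↥(maximalRealSubfield L)) ↥(maximalRealSubfield L))ˣ), hSrange ⟨k, hkK', rfl⟩⟩ :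
      ↥(quatAdelicNrd L Ha).range) ∈ (Subtype.val : ↥(quatAdelicNrd L Ha).range → (AdeleRing (𝓞 L) L)ˣ) ⁻¹' S := ⟨k, hkK', rfl⟩
  obtain ⟨c₀, hc₀C, hc₀k⟩ := hC₀S hkS
  have hNc₀ : quatAdelicNrd L Ha c₀ = con (k : (AdeleRing (𝓞 ↥(maximalRealSubfield L)) ↥(maximalRealSubfield L))ˣ) :=
    congrArg Subtype.val hc₀k
  have hc₀one : c₀ ∈ quatAdelicUnitsOne L Ha := by
    rw [mem_quatAdelicUnitsOne_iff, hNc₀, ideleNorm_ideleBaseChange_eq_one_iff]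
    exact (mem_normOneIdeles).1 k.2
  -- the principal factor: `con p ∈ Nrd-range ∩ Lˣ = Nrd Γ_h` (EICHLER)
  have hconp : con (((k : (AdeleRing (𝓞 ↥(maximalRealSubfield L)) ↥(maximalRealSubfield L))ˣ))⁻¹ * y) ∈
      (quatAdelicNrd L Ha).range ⊓ principalIdeles L := by
    refine Subgroup.mem_inf.2 ⟨?_, ideleBaseChange_mem_principalIdeles_of_mem L hkp'⟩
    rw [map_mul, map_inv, ← hNc₀, hy]
    exact Subgroup.mul_mem _ (Subgroup.inv_mem _ ⟨c₀, rfl⟩) ⟨(g : ↥(quatAdelicUnits L Ha)), rfl⟩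
  obtain ⟨γ₀, hγ₀Γ, hγ₀⟩ := Subgroup.mem_map.1 (hEichler hconp)
  have hγ₀one : γ₀ ∈ quatAdelicUnitsOne L Ha := quatRatLattice_le_quatAdelicUnitsOne L Ha hγ₀Γ
  refine ⟨⟨c₀, hc₀one⟩, hc₀C, ⟨γ₀, hγ₀one⟩⁻¹, Subgroup.inv_mem _ ((mem_quatRatLatticeOne_iff L Ha _).2 hγ₀Γ), ?_⟩
  -- `Nrd(c⁻¹ g γ₀⁻¹) = (con k)⁻¹ · con y · (con (k⁻¹ y))⁻¹ = 1`
  have hcoe : ((⟨c₀, hc₀one⟩⁻¹ * g * ⟨γ₀, hγ₀one⟩⁻¹ : ↥(quatAdelicUnitsOne L Ha)) : ↥(quatAdelicUnits L Ha)) =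
      c₀⁻¹ * (g : ↥(quatAdelicUnits L Ha)) * γ₀⁻¹ := rfl
  rw [hcoe, map_mul, map_mul, map_inv, map_inv, hNc₀, ← hy, hγ₀, map_mul, map_inv, hcon]
  group

end Base

/-! ## §4 The reduction: G1′ from Eichler's norm theorem in the model -/

section Reduction

variable (L : Type) [Field L] [NumberField L] [IsCMField L] (Ha : Matrix (Fin 2) (Fin 2) L)

/-- **G1′ MODULO EICHLER IN THE MODEL.**  For an anisotropic hermitian plane `h` over the CM field `L`: if every principal idèle of `L` that is an adelic reduced norm of
`D_h` is the reduced norm of a rational unit of `D_h` (`hEichler` — Eichler's norm theorem ★ D4 transported to the matrix model, K2E5-p08's `K2E5QuatNrdImageLattice`),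
then `D^{(1)}_{h,𝔸} ∕ Γ_h` is COMPACT (socket G1′ `Zeta.sig_K2E5QuatUnitsOneCocompact`).  Proof: (L1′) with the fibre (§2, ★ B7) and the base (§3).
[cite: VignerasLNM800, Ch. III §1 Thm. 1.4 (Fujisaki), Ch. III §2, §4 Thm. 4.1] [cite: WeilBNT1967, Ch. IV §3 Thm. 4, §4 Thm. 6] [cite: PlatonovRapinchuk1994, §5.3 Thm. 5.5] -/
theorem compactSpace_quatUnitsOne_quot_of_eichler (hHa : (Ha.map (cmConjRingHom L)).transpose = Ha)
    (han : ∀ x : Fin 2 → L, Literature.AlgebraicGeometry.ShimuraVarieties.hermForm (cmConjRingHom L) Ha x x = 0 → x = 0) (hdet : Ha.det ≠ 0)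
    (hEichler : (quatAdelicNrd L Ha).range ⊓ principalIdeles L ≤ (quatRatLattice L Ha).map (quatAdelicNrd L Ha)) :
    CompactSpace (↥(quatAdelicUnitsOne L Ha) ⧸ quatRatLatticeOne L Ha) := by
  refine compactSpace_quotient_of_compact_generation (quatRatLatticeOne L Ha)
    ((quatAdelicNrd L Ha).comp (quatAdelicUnitsOne L Ha).subtype) ?_ ?_
  · obtain ⟨C, hC, h⟩ := exists_isCompact_kernel_generation L Ha hHa han hdet
    exact ⟨C, hC, fun n hn => h n hn⟩
  · obtain ⟨C, hC, h⟩ := exists_isCompact_base_generation L Ha hHa hdet hEichler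
    exact ⟨C, hC, fun g => h g⟩

end Reduction

end Summit.HodgeConjecture.HodgeConjecture.Cruxes.H413.K2E5QuatUnitsOneCocompactPrep

end
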